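import Summits.HubbardSuperconductivity.HubbardSuperconductivity.Theses.IntrinsicLargeN
import Summits.HubbardSuperconductivity.HubbardSuperconductivity.Theorems.DeformationLadderDeformedRungGap

/-!
# Route `IntrinsicLargeN`, support `ReducedBCSAnchor` (item stmt-HubbardSuperconductivity-1657)

**The reduced d-wave BCS torus has extensive condensation energy in the summit's sector, at EVERY
doping `δ ∈ (0,1)`.** For every `g > 0` and `δ ∈ (0,1)` there are `c > 0` and `L₀` such that for all
`L ≥ L₀` (every parity; the item only asks for even `L`)
`minE(T − (g/L²)Δ_dᴴΔ_d | szSector N_L 0) + c L² ≤ minE(T | szSector N_L 0)`,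
`T = hubbardTorus 2 L 1 0`, `Δ_d = pairField dWaveFormFactor L`, `N_L = 2⌊(1−δ)L²/2⌋`
(`reducedBCSAnchor_proof`, whose type is the route declaration
`Summit.HubbardSuperconductivity.HubbardSuperconductivity.Theses.IntrinsicLargeN.ReducedBCSAnchor`).

Proof. This is the extensive gap `extensiveGap_all` of route `DeformationLadder`
(Theorems/DeformationLadderDeformedRungGap: regularised BCS trial state, d-wave Cooper logarithm,
sector transfer — `gap_at_side` of Theorems/ThermalWedgeTwTipContinuationEdgeOrder), whose only
doping-specific input, the tuning of the chemical potential of the trial state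
(`exists_mu_of_target_all`, targets `t ≥ L²/2 − O(L)`, i.e. densities `≥ 1/2`), is replaced here by a
band-bottom tuning valid at every filling (`exists_mu_of_target_low`): with `a = −4 + 2s²` and the
occupation tail cut at `τ = 2s²`, `N̄_L(a) ≤ 2·#{ε_L ≤ −4 + (2s)²} + L²(4D² + D⁴)/(8s⁴) ≤ 3s²L² + 8L + 8`
once `D ≤ s³` (`torusLevelCount_bottom_le`), while `N̄_L(s²/4) ≥ (2 − η)(L − 2)²/2` as before; the
intermediate value theorem then places every target `t ∈ [3s²L² + 8L + 8, (1 − η)L²]` at some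
`μ ∈ [−4 + 2s², s²/4]`, inside the range of the every-side Cooper bound `exists_gap_cooperLog_all`
with the same `s`. With `s = (1 − δ)/3`, `η = δ` the target `2⌊(1−δ)L²/2⌋ − 2KL` qualifies
eventually in `L`, and the budget arithmetic (`budget_arith_four`, `|μ| ≤ 4`) gives the gap `D²L²/2`.
Bardeen–Cooper–Schrieffer (1957); Bogoliubov (1958); Leggett, *Quantum Liquids* (2006) §5.4.
[folklore] No definitions are introduced.
-/

-- the mandated namespace `Summit.<Summit>.<Problem>.Theorems` repeats `HubbardSuperconductivity`
-- (single-problem summit, D-0017), which the `dupNamespace` linter flags on every declaration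
set_option linter.dupNamespace false

noncomputable section

namespace Summit.HubbardSuperconductivity.HubbardSuperconductivity.Theorems.IntrinsicLargeN

open Matrix Filter Finset
open Literature.MathematicalPhysics.QuantumLattice Literature.Probability.LatticeModels
open Summit.HubbardSuperconductivity.TwTipContinuation.IsogapTransport
open Summit.HubbardSuperconductivity.DeformationLadder.DeformedRung

/-- **Tuning the chemical potential of the BCS trial state at every filling (band-bottom
version).** For `0 < D ≤ s³`, `0 < s ≤ 1`, a deficit `η ∈ (0,1]` with `10D² ≤ η(s²/4)²` there is `L₀`
such that for all `L ≥ L₀` (every parity) every target `t ∈ [3s²L² + 8L + 8, (1 − η)L²]` is the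
mean number of the regularised d-wave BCS trial state at some `μ ∈ [−4 + 2s², s²/4]`:
`Σ_k (1 − (ε_L(k) − μ)/√((ε_L(k) − μ)² + D²ĝ_d(k)² + D⁴)) = t`. [folklore] -/
theorem exists_mu_of_target_low {D s η : ℝ} (hD : 0 < D) (hs : 0 < s) (hs1 : s ≤ 1)
    (hDs : D ≤ s ^ 3) (hη : 0 < η) (hη1 : η ≤ 1) (hDβ : 10 * D ^ 2 ≤ η * (s ^ 2 / 4) ^ 2) :
    ∃ L₀ : ℕ, ∀ (L : ℕ) [NeZero L], L₀ ≤ L → ∀ t : ℝ, 3 * s ^ 2 * (L : ℝ) ^ 2 + 8 * L + 8 ≤ t →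
      t ≤ (1 - η) * (L : ℝ) ^ 2 →
      ∃ μ : ℝ, -4 + 2 * s ^ 2 ≤ μ ∧ μ ≤ s ^ 2 / 4 ∧ ∑ k : TorusSite 2 L,
        (1 - (torusBand L k - μ) / Real.sqrt ((torusBand L k - μ) ^ 2 + D ^ 2 * dWaveGap k ^ 2 + D ^ 4)) = t := by
  refine ⟨⌈8 / η⌉₊ + 32, fun L _ hL t ht1 ht2 => ?_⟩
  have hL8 : 8 / η + 32 ≤ (L : ℝ) := by
    have h1 : ((⌈8 / η⌉₊ + 32 : ℕ) : ℝ) ≤ L := by exact_mod_cast hL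
    push_cast at h1
    have h3 : 8 / η ≤ (⌈8 / η⌉₊ : ℝ) := Nat.le_ceil _
    linarith
  have h8η : 0 < 8 / η := by positivity
  have hL32 : (32 : ℝ) ≤ L := by linarith
  have hLnat : 2 ≤ L := by exact_mod_cast (show (2 : ℝ) ≤ L by linarith)
  have hηL : 8 ≤ η * L := by
    have h := (div_le_iff₀ hη).1 (show 8 / η ≤ (L : ℝ) by linarith)
    linarith
  have hs2 : 0 < s ^ 2 := by positivity
  have hs21 : s ^ 2 ≤ 1 := by nlinarith
  have hs31 : s ^ 3 ≤ 1 := by nlinarith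
  have hD1 : D ≤ 1 := hDs.trans hs31
  have hD21 : D ^ 2 ≤ 1 := pow_le_one₀ hD.le hD1
  have hD4 : D ^ 4 ≤ D ^ 2 := by
    calc D ^ 4 = D ^ 2 * D ^ 2 := by ring
      _ ≤ D ^ 2 * 1 := by gcongr
      _ = D ^ 2 := by ring
  set a : ℝ := -4 + 2 * s ^ 2 with ha
  set β : ℝ := s ^ 2 / 4 with hβ
  have hβ0 : 0 < β := by positivity
  set f : ℝ → ℝ := fun μ => ∑ k : TorusSite 2 L,
    (1 - (torusBand L k - μ) / Real.sqrt ((torusBand L k - μ) ^ 2 + D ^ 2 * dWaveGap k ^ 2 + D ^ 4)) with hf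
  have hcont : Continuous f := continuous_occSum hD
  -- `f a ≤ t`: band-bottom level count below `−4 + (2s)²` and the occupation tail beyond `τ = 2s²`
  have hfa : f a ≤ t := by
    have hτ : (0 : ℝ) < 2 * s ^ 2 := by positivity
    have h1 := occSum_le (L := L) a hτ hD
    have e : a + 2 * s ^ 2 = -4 + (2 * s) ^ 2 := by rw [ha]; ring
    rw [e] at h1
    have hlev := torusLevelCount_bottom_le (L := L) (s := 2 * s) (by positivity)
    have hD2 : D ^ 2 ≤ s ^ 6 := by
      calc D ^ 2 ≤ (s ^ 3) ^ 2 := pow_le_pow_left₀ hD.le hDs 2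
        _ = s ^ 6 := by ring
    have htail : (4 * D ^ 2 + D ^ 4) / (2 * (2 * s ^ 2) ^ 2) ≤ 5 / 8 * s ^ 2 := by
      rw [div_le_iff₀ (by positivity)]
      linarith [hD2, hD4]
    have h2 : (L : ℝ) ^ 2 * ((4 * D ^ 2 + D ^ 4) / (2 * (2 * s ^ 2) ^ 2)) ≤ (L : ℝ) ^ 2 * (5 / 8 * s ^ 2) :=
      mul_le_mul_of_nonneg_left htail (by positivity)
    have h3 : f a ≤ 2 * ((2 * s * L / 2 + 2) ^ 2) + (L : ℝ) ^ 2 * (5 / 8 * s ^ 2) := by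
      calc f a ≤ 2 * (torusLevelCount L (-4 + (2 * s) ^ 2) : ℝ) +
            (L : ℝ) ^ 2 * ((4 * D ^ 2 + D ^ 4) / (2 * (2 * s ^ 2) ^ 2)) := h1
        _ ≤ _ := by gcongr
    have hL0 : (0 : ℝ) ≤ L := Nat.cast_nonneg L
    have hsL : s * (L : ℝ) ≤ L := by nlinarith
    linarith [h3, ht1, hsL, sq_nonneg (s * L)]
  -- `t ≤ f β`: half the torus lies below `β/4 > 0`
  have hfb : t ≤ f β := by
    have hτ : (0 : ℝ) < β / 2 := by positivity
    have hE : β / 4 + β / 2 < β := by linarith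
    have h1 := le_occSum (L := L) β hτ hE hD
    have hlev := sq_sub_two_le_torusLevelCount_of_pos (L := L) (by positivity : (0 : ℝ) < β / 4) hLnat
    have hfrac : (4 * D ^ 2 + D ^ 4) / (2 * (β / 2) ^ 2) ≤ η := by
      rw [div_le_iff₀ (by positivity)]
      linarith [hD4, hDβ]
    have hcnt0 : (0 : ℝ) ≤ torusLevelCount L (β / 4) := Nat.cast_nonneg _
    have h2η : 0 ≤ 2 - η := by linarith
    have h2 : (2 - η) * (((L : ℝ) - 2) ^ 2 / 2) ≤ f β :=
      calc (2 - η) * (((L : ℝ) - 2) ^ 2 / 2) ≤ (2 - η) * (torusLevelCount L (β / 4) : ℝ) :=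
            mul_le_mul_of_nonneg_left hlev h2η
        _ ≤ (2 - (4 * D ^ 2 + D ^ 4) / (2 * (β / 2) ^ 2)) * (torusLevelCount L (β / 4) : ℝ) :=
            mul_le_mul_of_nonneg_right (by linarith) hcnt0
        _ ≤ f β := h1
    have hprod : 0 ≤ (η * L - 8) * (L : ℝ) := mul_nonneg (by linarith) (Nat.cast_nonneg L)
    linarith [h2, ht2, hprod, hηL, hη1]
  -- intermediate value theorem on `[a, β]`
  have hab : a ≤ β := by rw [ha, hβ]; linarith [hs21]
  obtain ⟨μ, hμ, hfμ⟩ := intermediate_value_Icc hab hcont.continuousOn ⟨hfa, hfb⟩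
  exact ⟨μ, hμ.1, hμ.2, hfμ⟩

/-- Pure arithmetic of the final budget (the variant of `budget_arith` with `|μ| ≤ 4`): with
`2n − t = 2KL`, `K ≥ 1`, `K ≥ B₂/D²` and `L ≥ 4Λ₁/D²`, `Λ₁ = 8K + C₀(3/4 + K²)`, the lower bound
of `gap_at_side` is at least `D²L²/2`. [folklore] -/
theorem budget_arith_four {μ D K C₀ B₂ L g : ℝ} (hD : 0 < D) (hL : 0 < L) (hK1 : 1 ≤ K)
    (hKB : B₂ / D ^ 2 ≤ K) (hμ : |μ| ≤ 4) (hg : g = 2 * K * L)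
    (hbig : 4 * (8 * K + C₀ * (3 / 4 + K ^ 2)) / D ^ 2 ≤ L) :
    D ^ 2 / 2 * L ^ 2 ≤ μ * g + D ^ 2 * L ^ 2 - C₀ * (L / 2 + (L ^ 2 + g ^ 2) / (4 * L)) -
      B₂ * L ^ 2 * (L ^ 2 / g ^ 2) := by
  have hK0 : 0 < K := by linarith
  rw [abs_le] at hμ
  have h1 : -8 * K * L ≤ μ * g := by rw [hg]; nlinarith [mul_pos hK0 hL]
  have h3 : C₀ * (L / 2 + (L ^ 2 + g ^ 2) / (4 * L)) = C₀ * (3 / 4 + K ^ 2) * L := by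
    rw [hg]; field_simp; ring
  have h4 : B₂ * L ^ 2 * (L ^ 2 / g ^ 2) ≤ D ^ 2 / 4 * L ^ 2 := by
    rw [hg]
    have hK2 : B₂ / D ^ 2 ≤ K ^ 2 := hKB.trans (by nlinarith)
    rw [div_le_iff₀ (by positivity)] at hK2
    have e : B₂ * L ^ 2 * (L ^ 2 / (2 * K * L) ^ 2) = B₂ / (4 * K ^ 2) * L ^ 2 := by field_simp; ring
    rw [e]
    refine mul_le_mul_of_nonneg_right ?_ (by positivity)
    rw [div_le_iff₀ (by positivity)]
    nlinarith
  have h5 : (8 * K + C₀ * (3 / 4 + K ^ 2)) * L ≤ D ^ 2 / 4 * L ^ 2 := by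
    rw [div_le_iff₀ (by positivity)] at hbig
    nlinarith
  rw [h3]
  nlinarith

/-- **The extensive gap of the `U = 0` reduced d-wave BCS torus at EVERY doping `δ ∈ (0,1)` and
every side.** For `δ ∈ (0,1)` and `c > 0` there is `κ > 0` such that, eventually in `L` (odd `L`
included), `κ L² ≤ E_L(0,0) − E_L(0,c)` in the canonical sector `(2⌊(1−δ)L²/2⌋, S^z = 0)`, where
`E_L(0,g) = minEnergyOn (hubbardTorus 2 L 1 0 − (g/L²) Δ_dᴴΔ_d) (szSector (2⌊(1−δ)L²/2⌋) 0)`.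
[folklore] -/
theorem extensiveGap_allDoping (δ : ℝ) (hδ : δ ∈ Set.Ioo (0 : ℝ) 1) (c : ℝ) (hc : 0 < c) :
    ∃ κ : ℝ, 0 < κ ∧ ∃ L₀ : ℕ, ∀ (L : ℕ) [NeZero L], L₀ ≤ L →
      κ * (L : ℝ) ^ 2 ≤
        (Matrix.minEnergyOn (hubbardTorus 2 L 1 0) (szSector (2 * ⌊(1 - δ) * (L : ℝ) ^ 2 / 2⌋₊) 0))
          - (Matrix.minEnergyOn (hubbardTorus 2 L 1 0 - ((c / (L : ℝ) ^ 2 : ℝ) : ℂ) •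
              ((pairField dWaveFormFactor L)ᴴ * pairField dWaveFormFactor L))
                (szSector (2 * ⌊(1 - δ) * (L : ℝ) ^ 2 / 2⌋₊) 0)) := by
  obtain ⟨hδ1, hδ2⟩ := hδ
  have h1δ : 0 < 1 - δ := by linarith
  -- the band-bottom scale `s = (1 − δ)/3`, ceiling `β = s²/4`, gap buffer `D ≤ min(s²δ/16, s³)`
  set s : ℝ := (1 - δ) / 3 with hs
  have hs0 : 0 < s := by positivity
  have hs1 : s ≤ 1 := by rw [hs]; linarith
  have hs2 : 0 < s ^ 2 := by positivity
  obtain ⟨D, hD, hDcap, hD100, L₁, hcoop⟩ := exists_gap_cooperLog_all (s := s) hs0 hs1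
    (max 2 (1 / (4 * c))) (D₁ := min (s ^ 2 * δ / 16) (s ^ 3)) (lt_min (by positivity) (by positivity))
  have hD1 : D ≤ 1 := hD100.trans (by norm_num)
  have hDs : D ≤ s ^ 3 := hDcap.trans (min_le_right _ _)
  have hDβ : 10 * D ^ 2 ≤ δ * (s ^ 2 / 4) ^ 2 := by
    have h0 : D ≤ s ^ 2 * δ / 16 := hDcap.trans (min_le_left _ _)
    have h1 : D ^ 2 ≤ (s ^ 2 * δ / 16) ^ 2 := pow_le_pow_left₀ hD.le h0 2
    have h2 : δ ^ 2 ≤ δ := by nlinarith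
    have h3 : (s ^ 2 * δ / 16) ^ 2 ≤ (s ^ 2) ^ 2 * δ / 256 := by
      have h4 : (s ^ 2) ^ 2 * δ ^ 2 ≤ (s ^ 2) ^ 2 * δ := mul_le_mul_of_nonneg_left h2 (sq_nonneg _)
      have e : (s ^ 2 * δ / 16) ^ 2 = (s ^ 2) ^ 2 * δ ^ 2 / 256 := by ring
      rw [e]
      linarith
    have e2 : δ * (s ^ 2 / 4) ^ 2 = (s ^ 2) ^ 2 * δ / 16 := by ring
    have h5 : 0 ≤ (s ^ 2) ^ 2 * δ := by positivity
    rw [e2]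
    linarith
  set Cd := (∑ e ∈ insert 0 unitSteps, ‖((dWaveFormFactor e / Real.sqrt 2 : ℝ) : ℂ)‖ * 2) ^ 2 with hCd
  have hCd0 : 0 ≤ Cd := by positivity
  set C₀ : ℝ := 8 + c * (Cd / 2 + 256) with hC₀
  set B₂ : ℝ := 16 + c * Cd with hB₂
  set K : ℝ := B₂ / D ^ 2 + 1 with hK
  have hK1 : 1 ≤ K := by rw [hK]; exact le_add_of_nonneg_left (by positivity)
  have hK0 : 0 ≤ K := by linarith
  have hKB : B₂ / D ^ 2 ≤ K := by rw [hK]; linarith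
  obtain ⟨L₂, htune⟩ := exists_mu_of_target_low hD hs0 hs1 hDs hδ1 hδ2.le hDβ
  set Λ₁ : ℝ := 8 * K + C₀ * (3 / 4 + K ^ 2) with hΛ₁
  refine ⟨D ^ 2 / 2, by positivity,
    max L₁ (max L₂ (max 3 (max ⌈4 * Λ₁ / D ^ 2⌉₊ ⌈(4 * K + 36) / (1 - δ)⌉₊))), fun L _ hL => ?_⟩
  have hL₁ : L₁ ≤ L := (le_max_left _ _).trans hL
  have hL₂ : L₂ ≤ L := ((le_max_left _ _).trans (le_max_right _ _)).trans hL
  have hL3 : 3 ≤ L :=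
    (((le_max_left _ _).trans (le_max_right _ _)).trans (le_max_right _ _)).trans hL
  have hLbig : 4 * Λ₁ / D ^ 2 ≤ (L : ℝ) :=
    Nat.ceil_le.1 (((((le_max_left _ _).trans (le_max_right _ _)).trans (le_max_right _ _)).trans
      (le_max_right _ _)).trans hL)
  have hLK : (4 * K + 36) / (1 - δ) ≤ (L : ℝ) :=
    Nat.ceil_le.1 (((((le_max_right _ _).trans (le_max_right _ _)).trans (le_max_right _ _)).trans
      (le_max_right _ _)).trans hL)
  have hLr : (0 : ℝ) < L := by exact_mod_cast (show 0 < L by omega)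
  have hL2pos : (0 : ℝ) < (L : ℝ) ^ 2 := by positivity
  have hL1r : (1 : ℝ) ≤ L := by exact_mod_cast (show 1 ≤ L by omega)
  -- the sector and the target mean number
  set n : ℕ := ⌊(1 - δ) * (L : ℝ) ^ 2 / 2⌋₊ with hn
  have hx0 : 0 ≤ (1 - δ) * (L : ℝ) ^ 2 / 2 := by positivity
  have hnle : (n : ℝ) ≤ (1 - δ) * (L : ℝ) ^ 2 / 2 := Nat.floor_le hx0
  have hnge : (1 - δ) * (L : ℝ) ^ 2 / 2 < n + 1 := Nat.lt_floor_add_one _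
  have hδL0 : 0 ≤ δ * (L : ℝ) ^ 2 := by positivity
  have hn2 : 2 * (n : ℝ) ≤ (L : ℝ) ^ 2 := by linarith
  set t : ℝ := 2 * n - 2 * K * L with ht
  have hKL : 0 ≤ 2 * K * (L : ℝ) := by positivity
  -- the target lies in the tuning window `[3s²L² + 8L + 8, (1 − δ)L²]`
  have hKL' : (4 * K + 36) * (L : ℝ) ≤ (1 - δ) * (L : ℝ) ^ 2 := by
    have h := (div_le_iff₀ h1δ).1 hLK
    have h' := mul_le_mul_of_nonneg_right h hLr.le
    have e : (L : ℝ) * (1 - δ) * L = (1 - δ) * (L : ℝ) ^ 2 := by ring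
    rw [e] at h'
    exact h'
  have h3s2 : 3 * s ^ 2 ≤ (1 - δ) / 3 := by
    have e : 3 * s ^ 2 = (1 - δ) * (1 - δ) / 3 := by rw [hs]; ring
    rw [e]
    have : (1 - δ) * (1 - δ) ≤ (1 - δ) * 1 := mul_le_mul_of_nonneg_left (by linarith) h1δ.le
    linarith
  have h3s : 3 * s ^ 2 * (L : ℝ) ^ 2 ≤ (1 - δ) / 3 * (L : ℝ) ^ 2 :=
    mul_le_mul_of_nonneg_right h3s2 hL2pos.le
  have h2n : (1 - δ) * (L : ℝ) ^ 2 - 2 ≤ 2 * n := by linarith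
  have hKL0 : 0 ≤ K * (L : ℝ) := by positivity
  have ht1 : 3 * s ^ 2 * (L : ℝ) ^ 2 + 8 * L + 8 ≤ t := by
    rw [ht]
    linarith [h3s, h2n, hKL', hKL0, hL1r]
  have ht2 : t ≤ (1 - δ) * (L : ℝ) ^ 2 := by rw [ht]; linarith
  obtain ⟨μ, hμa, hμb, hocc⟩ := htune L hL₂ t ht1 ht2
  clear htune
  have hs21 : s ^ 2 ≤ 1 := pow_le_one₀ hs0.le hs1
  have hμabs : |μ| ≤ 4 := by
    rw [abs_le]
    constructor
    · linarith [hs2]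
    · linarith [hs21]
  -- the Cooper bound at the tuned chemical potential
  have hS := hcoop L hL₁ μ hμa hμb
  clear hcoop
  set S := ∑ k : TorusSite 2 L, dWaveGap k ^ 2 /
    (2 * Real.sqrt ((torusBand L k - μ) ^ 2 + D ^ 2 * dWaveGap k ^ 2 + D ^ 4)) with hSdef
  rw [le_inv_mul_iff₀ hL2pos] at hS
  have hS1 : 2 * (L : ℝ) ^ 2 ≤ S :=
    calc 2 * (L : ℝ) ^ 2 = (L : ℝ) ^ 2 * 2 := by ring
      _ ≤ (L : ℝ) ^ 2 * max 2 (1 / (4 * c)) := mul_le_mul_of_nonneg_left (le_max_left _ _) hL2pos.le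
      _ ≤ S := hS
  have hS2 : (L : ℝ) ^ 2 ≤ 4 * c * S := by
    have h := (mul_le_mul_of_nonneg_left (le_max_right (2 : ℝ) (1 / (4 * c))) hL2pos.le).trans hS
    rw [show (L : ℝ) ^ 2 * (1 / (4 * c)) = (L : ℝ) ^ 2 / (4 * c) by ring,
      div_le_iff₀ (by positivity)] at h
    linarith
  -- the side estimate
  have hgt : ∑ k : TorusSite 2 L, (1 - (torusBand L k - μ) /
      Real.sqrt ((torusBand L k - μ) ^ 2 + D ^ 2 * dWaveGap k ^ 2 + D ^ 4)) < 2 * n := by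
    rw [hocc, ht]
    have : 0 < 2 * K * (L : ℝ) := by positivity
    linarith
  have hside := gap_at_side hL3 hc hD hn2 hS1 hS2 hgt
  rw [hocc] at hside
  have hg : 2 * (n : ℝ) - t = 2 * K * L := by rw [ht]; ring
  have hbud := budget_arith_four (C₀ := C₀) (B₂ := B₂) hD hLr hK1 hKB hμabs hg
    (by rw [hΛ₁] at hLbig; exact hLbig)
  rw [← hCd, ← hC₀, ← hB₂] at hside
  linarith

/-- **Reduced BCS anchor** (support item `ReducedBCSAnchor` of route `IntrinsicLargeN`,
stmt-HubbardSuperconductivity-1657). For every `g > 0` and `δ ∈ (0,1)` there are `c > 0`, `L₀` with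
`minEnergyOn (hubbardTorus 2 L 1 0 − (g/L²)Δ_dᴴΔ_d) (szSector N_L 0) + c L² ≤
 minEnergyOn (hubbardTorus 2 L 1 0) (szSector N_L 0)` for all even `L ≥ L₀`, `N_L = 2⌊(1−δ)L²/2⌋`:
the extensive condensation energy of the reduced d-wave BCS torus in the summit's sector.
Bardeen–Cooper–Schrieffer (1957); Leggett, *Quantum Liquids* (2006) §5.4. [folklore] -/
theorem reducedBCSAnchor_proof :
    Summit.HubbardSuperconductivity.HubbardSuperconductivity.Theses.IntrinsicLargeN.ReducedBCSAnchor := by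
  intro g hg δ hδ
  obtain ⟨κ, hκ, L₀, h⟩ := extensiveGap_allDoping δ hδ g hg
  refine ⟨κ, hκ, L₀, fun L _ hL _ => ?_⟩
  have := h L hL
  linarith

end Summit.HubbardSuperconductivity.HubbardSuperconductivity.Theorems.IntrinsicLargeN
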